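import Summits.CriticalPhenomena.PercolationContinuityZ3.Theorems.PercNearOneGluingNoHeavyLowerTailSunflowerLeafLeafFreeCap
import HarnessLib

/-!
# `NoHeavyLowerTail` (crux stmt-CriticalPhenomena-4575), abstract sunflower cubic: `FreeFour` REDUCES TO ONE CROSS-TERM INEQUALITY
# on the `z₂`-aligned class (`CrossIneq`)

Support file (seat `prim-ineq-prove-1` gen 67; `--supports stmt-CriticalPhenomena-4575`).  No `sorry`, no named facts; one definition
(`CrossIneq`, the residual statement, conjecture-shaped) used only as a hypothesis.  Memo: run/shared/lean/prim/prim-ineq-prove-1/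
FINDING-FREEFOUR-prove1-g67.md §5.1.

After the column-resource exchange (`freeFour_of_freeFourCore`), the capped case (`freeFour_of_xCap`) and the diagonal class
(`freeFour_of_xLink`), a `FreeFour` family has exactly ONE petal `k` whose column resource `x_k` is off its link, and every other petal
is `z₂`-diagonal, hence ALIGNED in the `z₂`-picture (`g·u_j ≤ a·l_j`, `u_j = τ+(1−τ)(s+(1−s)x_j)`, `l_j = τ(σ+(1−σ)y_j) + (1−τ)·block_j`)
and the others merge (`aligned_merge_prod_le`) into one pair `(Û, L̂)`.  If `k` is aligned too everything merges (`interp_prod_le`);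
otherwise the two-body product `(tÛ+(1−t)L̂)(tu_k+(1−t)l_k)` is bounded coefficientwise in `t`: `Û·u_k ≤ a` is the column budget
(`prod_wavg_le`), `L̂·l_k ≤ g` is the capped pendant lemma (`cappedPendant_holds`), and the CROSS TERM `Û·l_k + L̂·u_k ≤ a + g` is the
hypothesis:
* `CrossIneq σ s τ α₀₀ α₀₁ α₁₀ α₁₁` — for every admissible family (the hypotheses of `FreeFour`) with a distinguished petal `k` and all
  other column resources at their links: `(∏_{j≠k} u_j)·l_k·g^(n−2) + (∏_{j≠k} l_j)·u_k·a^(n−2) ≤ (a+g)·a^(n−2)·g^(n−2)` (`t`-free;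
  numerically without violation, memo §5; equality for {full, floors} and {floor; full, floors});
* **`freeFour_of_cross`** — `CrossIneq σ s τ α ⇒ FreeFour σ s τ t α` for all `t` (coins in `[0,1]`, floors `0 < α₀₀ ≤ α₀₁, α₁₀ ≤ α₁₁ ≤ 1`).
So the leaf-leaf lemma (`leafLeaf_of_freeFour`) — and with it `LeafLeafSafe` up to the boundary/degenerate strata of the memo §1 — rests on
`CrossIneq` alone.
-/

noncomputable section

namespace Summit.CriticalPhenomena.PercolationContinuityZ3.Theorems.SunflowerPartition

namespace SafeCalc

namespace LeafLeafZ

open Finset LinkedCurrency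

/-- **`CrossIneq` (statement)**: the cross-term inequality of memo §5.1 — for an admissible `FreeFour` family with a distinguished petal `k`
and all other column resources at their links, `(∏_{j≠k} u_j)·l_k·g^(n−2) + (∏_{j≠k} l_j)·u_k·a^(n−2) ≤ (a+g)·a^(n−2)·g^(n−2)` where
`u_j = τ+(1−τ)(s+(1−s)x_j)`, `l_j = τ(σ+(1−σ)y_j) + (1−τ)·block_j`, `a, g` their floor values.  Open. [conjecture-shaped hypothesis, this work] -/
def CrossIneq (σ s τ α00 α01 α10 α11 : ℝ) : Prop :=
  ∀ (n : ℕ) (e g f h y x : Fin n → ℝ) (k : Fin n), 2 ≤ n →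
    (∀ j, α00 ≤ e j) → (∀ j, α01 ≤ g j) → (∀ j, α10 ≤ f j) → (∀ j, α11 ≤ h j) → (∀ j, h j ≤ 1) →
    (∀ j, e j ≤ g j) → (∀ j, e j ≤ f j) → (∀ j, g j ≤ h j) → (∀ j, f j ≤ h j) →
    (∀ j, (1 - s) * e j + s * g j ≤ y j) → (∀ j, y j ≤ 1) → (∀ j, (1 - σ) * e j + σ * f j ≤ x j) → (∀ j, x j ≤ 1) →
    ∏ j, e j ≤ α00 ^ (n - 1) → ∏ j, g j ≤ α01 ^ (n - 1) → ∏ j, f j ≤ α10 ^ (n - 1) → ∏ j, h j ≤ α11 ^ (n - 1) →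
    ∏ j, ((1 - s) * e j + s * g j) ≤ ((1 - s) * α00 + s * α01) ^ (n - 1) →
    ∏ j, ((1 - s) * f j + s * h j) ≤ ((1 - s) * α10 + s * α11) ^ (n - 1) →
    ∏ j, ((1 - σ) * e j + σ * f j) ≤ ((1 - σ) * α00 + σ * α10) ^ (n - 1) →
    ∏ j, ((1 - σ) * g j + σ * h j) ≤ ((1 - σ) * α01 + σ * α11) ^ (n - 1) →
    ∏ j, ((1 - σ) * ((1 - s) * e j + s * g j) + σ * ((1 - s) * f j + s * h j)) ≤
      ((1 - σ) * ((1 - s) * α00 + s * α01) + σ * ((1 - s) * α10 + s * α11)) ^ (n - 1) →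
    ∏ j, y j ≤ ((1 - s) * α00 + s * α01) ^ (n - 1) →
    ∏ j, x j ≤ ((1 - σ) * α00 + σ * α10) ^ (n - 1) →
    (∀ j, j ≠ k → x j = (1 - σ) * e j + σ * f j) →
    (∏ j ∈ univ.erase k, (τ + (1 - τ) * (s + (1 - s) * x j))) *
        (τ * (σ + (1 - σ) * y k) + (1 - τ) * ((1 - σ) * ((1 - s) * e k + s * g k) + σ * ((1 - s) * f k + s * h k))) *
        (τ * (σ + (1 - σ) * ((1 - s) * α00 + s * α01)) +
          (1 - τ) * ((1 - σ) * ((1 - s) * α00 + s * α01) + σ * ((1 - s) * α10 + s * α11))) ^ (n - 2) +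
      (∏ j ∈ univ.erase k, (τ * (σ + (1 - σ) * y j) + (1 - τ) * ((1 - σ) * ((1 - s) * e j + s * g j) + σ * ((1 - s) * f j + s * h j)))) *
        (τ + (1 - τ) * (s + (1 - s) * x k)) * (τ + (1 - τ) * (s + (1 - s) * ((1 - σ) * α00 + σ * α10))) ^ (n - 2) ≤
    (τ + (1 - τ) * (s + (1 - s) * ((1 - σ) * α00 + σ * α10)) +
        (τ * (σ + (1 - σ) * ((1 - s) * α00 + s * α01)) +
          (1 - τ) * ((1 - σ) * ((1 - s) * α00 + s * α01) + σ * ((1 - s) * α10 + s * α11)))) *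
      (τ + (1 - τ) * (s + (1 - s) * ((1 - σ) * α00 + σ * α10))) ^ (n - 2) *
      (τ * (σ + (1 - σ) * ((1 - s) * α00 + s * α01)) +
        (1 - τ) * ((1 - σ) * ((1 - s) * α00 + s * α01) + σ * ((1 - s) * α10 + s * α11))) ^ (n - 2)

set_option maxHeartbeats 400000 in
/-- **`CrossIneq ⇒ FreeFour`** (coins in `[0,1]`, floors `0 < α₀₀ ≤ α₀₁, α₁₀ ≤ α₁₁ ≤ 1`). [this work] -/
theorem freeFour_of_cross {σ s τ t α00 α01 α10 α11 : ℝ} (hσ0 : 0 ≤ σ) (hσ1 : σ ≤ 1) (hs0 : 0 ≤ s) (hs1 : s ≤ 1)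
    (hτ0 : 0 ≤ τ) (hτ1 : τ ≤ 1) (ht0 : 0 ≤ t) (ht1 : t ≤ 1) (hα : 0 < α00) (h01 : α00 ≤ α01) (h10 : α00 ≤ α10)
    (h0111 : α01 ≤ α11) (h1011 : α10 ≤ α11) (h11 : α11 ≤ 1) (hX : CrossIneq σ s τ α00 α01 α10 α11) :
    FreeFour σ s τ t α00 α01 α10 α11 := by
  classical
  refine freeFour_of_freeFourCore hσ0 hσ1 hs0 hs1 hτ0 hτ1 ht0 ht1 hα ?_
  intro n e g f h y x he hg hf hh hh1 leg lef lgh lfh ly hy1 lx hx1 Be Bg Bf Bh Br0 Br1 Bc0 Bc1 BA By Bx _hcy hcx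
  -- a capped column resource
  by_cases hxcap : ∃ k, x k = 1
  · obtain ⟨k, hk⟩ := hxcap
    exact freeFour_of_xCap hσ0 hσ1 hs0 hs1 hτ0 hτ1 ht0 ht1 hα h01 h10 h0111 h1011 h11 e g f h y x he hg hf hh hh1 lef lgh lfh ly hy1
      lx Bh Br1 Bc1 BA By Bx k hk
  have hxlt1 : ∀ j, x j < 1 := fun j => lt_of_le_of_ne (hx1 j) fun h1 => hxcap ⟨j, h1⟩
  -- no column resource off its link: the diagonal class
  by_cases hxint : ∃ k, (1 - σ) * e k + σ * f k < x k
  swap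
  · have hxl : ∀ j, x j = (1 - σ) * e j + σ * f j := fun j => le_antisymm (not_lt.1 fun h1 => hxint ⟨j, h1⟩) (lx j)
    have e1 : ∀ j, τ * t + τ * (1 - t) * σ + (1 - τ) * t * s + τ * (1 - t) * (1 - σ) * y j + (1 - τ) * t * (1 - s) * x j +
        (1 - τ) * (1 - t) * ((1 - σ) * ((1 - s) * e j + s * g j) + σ * ((1 - s) * f j + s * h j)) =
        τ * t + τ * (1 - t) * σ + (1 - τ) * t * s + τ * (1 - t) * (1 - σ) * y j + (1 - τ) * t * (1 - s) * ((1 - σ) * e j + σ * f j) +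
        (1 - τ) * (1 - t) * ((1 - σ) * ((1 - s) * e j + s * g j) + σ * ((1 - s) * f j + s * h j)) := fun j => by rw [hxl j]
    rw [prod_congr rfl fun j _ => e1 j]
    exact freeFour_of_xLink hσ0 hσ1 hs0 hs1 hτ0 hτ1 ht0 ht1 hα h01 h10 h0111 h1011 h11 e g f h y he hg hf hh hh1 leg lef lgh lfh ly hy1
      By Br1 BA Bc0
  obtain ⟨k, hk⟩ := hxint
  have hxl : ∀ j, j ≠ k → x j = (1 - σ) * e j + σ * f j := by
    intro j hj
    by_contra hne
    have hlt : (1 - σ) * e j + σ * f j < x j := lt_of_le_of_ne (lx j) (Ne.symm hne)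
    exact hj (hcx k j hk (hxlt1 k) hlt (hxlt1 j)).symm
  -- common data (as in `freeFour_of_xLink` / `freeFour_of_xCap`)
  have hσ' : 0 ≤ 1 - σ := sub_nonneg.2 hσ1
  have hs' : 0 ≤ 1 - s := sub_nonneg.2 hs1
  have hτ' : 0 ≤ 1 - τ := sub_nonneg.2 hτ1
  have ht' : 0 ≤ 1 - t := sub_nonneg.2 ht1
  have hα01_1 : α01 ≤ 1 := h0111.trans h11
  have hα10_1 : α10 ≤ 1 := h1011.trans h11
  set b : ℝ := (1 - s) * α00 + s * α01 with hb
  set β : ℝ := (1 - s) * α10 + s * α11 with hβ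
  set c : ℝ := (1 - σ) * α00 + σ * α10 with hc
  set c1 : ℝ := (1 - σ) * α01 + σ * α11 with hc1
  set gv : ℝ := τ * (σ + (1 - σ) * b) + (1 - τ) * ((1 - σ) * b + σ * β) with hgv
  set av : ℝ := τ + (1 - τ) * (s + (1 - s) * c) with hav
  have hb0 : 0 < b := by
    have k1 := mul_nonneg hs0 (sub_nonneg.2 h01)
    have e1 : b = α00 + s * (α01 - α00) := by rw [hb]; ring
    rw [e1]; linarith
  have hbβ : b ≤ β := by
    have k1 := mul_nonneg hs' (sub_nonneg.2 h10)
    have k2 := mul_nonneg hs0 (sub_nonneg.2 h0111)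
    have e1 : β - b = (1 - s) * (α10 - α00) + s * (α11 - α01) := by rw [hb, hβ]; ring
    linarith
  have hβ1 : β ≤ 1 := by
    have k1 := mul_le_mul_of_nonneg_left hα10_1 hs'
    have k2 := mul_le_mul_of_nonneg_left h11 hs0
    rw [hβ]; linarith
  have hc0 : 0 < c := by
    have k1 := mul_nonneg hσ0 (sub_nonneg.2 h10)
    have e1 : c = α00 + σ * (α10 - α00) := by rw [hc]; ring
    rw [e1]; linarith
  have h3 : σ + (1 - σ) * b ≤ 1 := by
    have k1 := mul_le_mul_of_nonneg_left (hbβ.trans hβ1) hσ'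
    linarith
  have hgv0 : 0 < gv := by
    have k0 : σ * β ≤ σ * 1 := mul_le_mul_of_nonneg_left hβ1 hσ0
    have k1 : 0 ≤ τ * (σ + (1 - σ) * b - ((1 - σ) * b + σ * β)) := mul_nonneg hτ0 (by linarith)
    have k2 : 0 ≤ σ * (β - b) := mul_nonneg hσ0 (sub_nonneg.2 hbβ)
    have e1 : gv = b + σ * (β - b) + τ * (σ + (1 - σ) * b - ((1 - σ) * b + σ * β)) := by rw [hgv]; ring
    rw [e1]; linarith
  have hga : gv ≤ av := by
    have h2 : c1 ≤ 1 := by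
      have k1 := mul_le_mul_of_nonneg_left hα01_1 hσ'
      have k2 := mul_le_mul_of_nonneg_left h11 hσ0
      rw [hc1]; linarith
    have k1 : 0 ≤ τ * (1 - (σ + (1 - σ) * b)) := mul_nonneg hτ0 (sub_nonneg.2 h3)
    have k2 : 0 ≤ (1 - τ) * s * (1 - c1) := mul_nonneg (mul_nonneg hτ' hs0) (sub_nonneg.2 h2)
    have e1 : av - gv = τ * (1 - (σ + (1 - σ) * b)) + (1 - τ) * s * (1 - c1) := by rw [hav, hgv, hb, hβ, hc, hc1]; ring
    linarith
  have hav0 : 0 < av := hgv0.trans_le hga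
  have hr0b : ∀ j, b ≤ (1 - s) * e j + s * g j := fun j => by
    have k1 := mul_le_mul_of_nonneg_left (he j) hs'
    have k2 := mul_le_mul_of_nonneg_left (hg j) hs0
    rw [hb]; linarith
  have hr1β : ∀ j, β ≤ (1 - s) * f j + s * h j := fun j => by
    have k1 := mul_le_mul_of_nonneg_left (hf j) hs'
    have k2 := mul_le_mul_of_nonneg_left (hh j) hs0
    rw [hβ]; linarith
  have hr1_1 : ∀ j, (1 - s) * f j + s * h j ≤ 1 := fun j => by
    have k1 := mul_le_mul_of_nonneg_left ((lfh j).trans (hh1 j)) hs'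
    have k2 := mul_le_mul_of_nonneg_left (hh1 j) hs0
    linarith
  have hr01 : ∀ j, (1 - s) * e j + s * g j ≤ (1 - s) * f j + s * h j := fun j => by
    have k1 := mul_le_mul_of_nonneg_left (lef j) hs'
    have k2 := mul_le_mul_of_nonneg_left (lgh j) hs0
    linarith
  have hc0c : ∀ j, c ≤ (1 - σ) * e j + σ * f j := fun j => by
    have k1 := mul_le_mul_of_nonneg_left (he j) hσ'
    have k2 := mul_le_mul_of_nonneg_left (hf j) hσ0
    rw [hc]; linarith
  have hy0 : ∀ j, 0 ≤ y j := fun j => (hb0.le.trans (hr0b j)).trans (ly j)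
  -- the `z₂`-picture data
  set l : Fin n → ℝ := fun j => τ * (σ + (1 - σ) * y j) +
    (1 - τ) * ((1 - σ) * ((1 - s) * e j + s * g j) + σ * ((1 - s) * f j + s * h j)) with hl
  set u : Fin n → ℝ := fun j => τ + (1 - τ) * (s + (1 - s) * x j) with hu
  have hlg : ∀ j, gv ≤ l j := fun j => by
    have k1 : 0 ≤ τ * (1 - σ) * (y j - b) := mul_nonneg (mul_nonneg hτ0 hσ') (sub_nonneg.2 ((hr0b j).trans (ly j)))
    have k2 : 0 ≤ (1 - τ) * ((1 - σ) * ((1 - s) * e j + s * g j - b) + σ * ((1 - s) * f j + s * h j - β)) :=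
      mul_nonneg hτ' (add_nonneg (mul_nonneg hσ' (sub_nonneg.2 (hr0b j))) (mul_nonneg hσ0 (sub_nonneg.2 (hr1β j))))
    have e1 : l j - gv = τ * (1 - σ) * (y j - b) +
        (1 - τ) * ((1 - σ) * ((1 - s) * e j + s * g j - b) + σ * ((1 - s) * f j + s * h j - β)) := by
      simp only [hl]; rw [hgv]; ring
    linarith
  have hua : ∀ j, av ≤ u j := fun j => by
    have k1 := mul_nonneg (mul_nonneg hτ' hs') (sub_nonneg.2 ((hc0c j).trans (lx j)))
    have e1 : u j - av = (1 - τ) * (1 - s) * (x j - c) := by simp only [hu]; rw [hav]; ring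
    linarith
  have hl0 : ∀ j, 0 ≤ l j := fun j => hgv0.le.trans (hlg j)
  have hu0 : ∀ j, 0 ≤ u j := fun j => hav0.le.trans (hua j)
  have hne : (univ : Finset (Fin n)).Nonempty := ⟨k, mem_univ _⟩
  have hcard : (univ : Finset (Fin n)).card = n := by simp
  -- budgets of all `l`'s and all `u`'s
  have hBl : ∏ j, l j ≤ gv ^ (n - 1) := by
    have key := cappedPendant_holds (s := σ) (t := τ) (b := b) (β := β) (V := 1) hb0 hbβ hβ1 hσ0 hσ1 hτ0 hτ1 n y
      (fun j => (1 - s) * f j + s * h j) (fun j => (1 - s) * e j + s * g j)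
      (fun j => (hr0b j).trans (ly j)) hy1 hr1β hr1_1 hr0b ly hr01
      (by rw [hb]; exact By) (by rw [hβ, mul_one]; exact Br1) (by rw [hb, hβ, mul_one]; exact BA)
    have e1 : ∀ j, σ * τ + σ * (1 - τ) * ((1 - s) * f j + s * h j) + (1 - σ) * τ * y j +
        (1 - σ) * (1 - τ) * ((1 - s) * e j + s * g j) = l j := fun j => by simp only [hl]; ring
    have e2 : (σ * τ + σ * (1 - τ) * β + (1 - σ) * b) ^ (n - 1) * (τ + (1 - τ) * 1) = gv ^ (n - 1) := by rw [hgv]; ring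
    rw [← e2, ← prod_congr rfl fun j _ => e1 j]; exact key
  have hBu : ∏ j, u j ≤ av ^ (n - 1) := by
    have hρ0 : 0 ≤ (1 - τ) * (1 - s) := mul_nonneg hτ' hs'
    have hρ1 : (1 - τ) * (1 - s) ≤ 1 := by
      have k1 : (1 - τ) * (1 - s) ≤ (1 - τ) * 1 := mul_le_mul_of_nonneg_left (by linarith) hτ'
      linarith
    have hB' : ∏ j ∈ (univ : Finset (Fin n)), x j ≤ c ^ ((univ : Finset (Fin n)).card - 1) := by rw [hcard, hc]; exact Bx
    have key := prod_wavg_le (s := (1 - τ) * (1 - s)) (e := (1 : ℝ)) (f := c) hρ0 hρ1 zero_le_one hc0 univ hne x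
      (fun j _ => (hc0c j).trans (lx j)) hB'
    rw [hcard] at key
    have e1 : ∀ j, (1 - τ) * (1 - s) * x j + (1 - (1 - τ) * (1 - s)) * (1 : ℝ) = u j := fun j => by simp only [hu]; ring
    have e2 : ((1 - τ) * (1 - s) * c + (1 - (1 - τ) * (1 - s)) * (1 : ℝ)) ^ (n - 1) *
        ((1 - τ) * (1 - s) + (1 - (1 - τ) * (1 - s)) * (1 : ℝ)) = av ^ (n - 1) := by rw [hav]; ring
    rw [← e2, ← prod_congr rfl fun j _ => e1 j]; exact key
  -- alignment of the link petals
  have halj : ∀ j, j ≠ k → gv * u j ≤ av * l j := by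
    intro j hj
    have h1 : u j + gv ≤ l j + av := by
      have k1 : 0 ≤ τ * (1 - σ) * (y j - b) := mul_nonneg (mul_nonneg hτ0 hσ') (sub_nonneg.2 ((hr0b j).trans (ly j)))
      have k2a : 0 ≤ (1 - σ) * (g j - α01) + σ * (h j - α11) :=
        add_nonneg (mul_nonneg hσ' (sub_nonneg.2 (hg j))) (mul_nonneg hσ0 (sub_nonneg.2 (hh j)))
      have k2 : 0 ≤ (1 - τ) * s * ((1 - σ) * (g j - α01) + σ * (h j - α11)) := mul_nonneg (mul_nonneg hτ' hs0) k2a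
      have e1 : l j + av - (u j + gv) = τ * (1 - σ) * (y j - b) + (1 - τ) * s * ((1 - σ) * (g j - α01) + σ * (h j - α11)) := by
        simp only [hl, hu]; rw [hxl j hj, hgv, hav, hb, hβ, hc]; ring
      linarith
    have k3 := mul_le_mul_of_nonneg_left h1 hav0.le
    have k4 : 0 ≤ (av - gv) * (u j - av) := mul_nonneg (sub_nonneg.2 hga) (sub_nonneg.2 (hua j))
    have e3 : av * l j - gv * u j = (av * (l j + av) - av * (u j + gv)) + (av - gv) * (u j - av) := by ring
    linarith
  -- the factor and floor identities
  have efac : ∀ j, τ * t + τ * (1 - t) * σ + (1 - τ) * t * s + τ * (1 - t) * (1 - σ) * y j + (1 - τ) * t * (1 - s) * x j +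
      (1 - τ) * (1 - t) * ((1 - σ) * ((1 - s) * e j + s * g j) + σ * ((1 - s) * f j + s * h j)) =
      t * u j + (1 - t) * l j := fun j => by simp only [hl, hu]; ring
  have eF : τ * t + τ * (1 - t) * σ + (1 - τ) * t * s +
      τ * (1 - t) * (1 - σ) * ((1 - s) * α00 + s * α01) + (1 - τ) * t * (1 - s) * ((1 - σ) * α00 + σ * α10) +
      (1 - τ) * (1 - t) * ((1 - σ) * ((1 - s) * α00 + s * α01) + σ * ((1 - s) * α10 + s * α11)) = t * av + (1 - t) * gv := by
    rw [hav, hgv, hb, hβ, hc]; ring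
  rw [eF, prod_congr rfl fun j _ => efac j]
  -- case 1: the special petal is aligned too — merge everything
  by_cases halk : gv * u k ≤ av * l k
  · have hal : ∀ j ∈ (univ : Finset (Fin n)), gv * u j ≤ av * l j := by
      intro j _
      by_cases hj : j = k
      · rw [hj]; exact halk
      · exact halj j hj
    have key := interp_prod_le ht0 ht1 hav0 hgv0 univ hne u l (fun j _ => hu0 j) (fun j _ => hl0 j) hal
      (by rw [hcard]; exact hBu) (by rw [hcard]; exact hBl)
    rw [hcard] at key; exact key
  -- case 2: the special petal is anti-aligned — merge the others, bound the two-body product coefficientwise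
  rcases Nat.lt_or_ge n 2 with hn1 | hn2
  · -- a single petal: every factor is at most `1`
    have hn : n - 1 = 0 := by omega
    have hle1 : ∀ j, t * u j + (1 - t) * l j ≤ 1 := by
      intro j
      have hu1 : u j ≤ 1 := by
        have k0 : (1 - s) * x j ≤ (1 - s) * 1 := mul_le_mul_of_nonneg_left (hx1 j) hs'
        have k1 : (1 - τ) * (s + (1 - s) * x j) ≤ (1 - τ) * 1 := mul_le_mul_of_nonneg_left (by linarith) hτ'
        have e1 : u j = τ + (1 - τ) * (s + (1 - s) * x j) := by simp only [hu]
        rw [e1]; linarith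
      have hl1 : l j ≤ 1 := by
        have hblk1 : (1 - σ) * ((1 - s) * e j + s * g j) + σ * ((1 - s) * f j + s * h j) ≤ 1 := by
          have k1 := mul_le_mul_of_nonneg_left ((hr01 j).trans (hr1_1 j)) hσ'
          have k2 := mul_le_mul_of_nonneg_left (hr1_1 j) hσ0
          linarith
        have k0 : (1 - σ) * y j ≤ (1 - σ) * 1 := mul_le_mul_of_nonneg_left (hy1 j) hσ'
        have k1 : τ * (σ + (1 - σ) * y j) ≤ τ * 1 := mul_le_mul_of_nonneg_left (by linarith) hτ0
        have k2 := mul_le_mul_of_nonneg_left hblk1 hτ'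
        have e1 : l j = τ * (σ + (1 - σ) * y j) +
            (1 - τ) * ((1 - σ) * ((1 - s) * e j + s * g j) + σ * ((1 - s) * f j + s * h j)) := by simp only [hl]
        rw [e1]; linarith
      have k1 := mul_le_mul_of_nonneg_left hu1 ht0
      have k2 := mul_le_mul_of_nonneg_left hl1 ht'
      linarith
    have hP1 : ∏ j, (t * u j + (1 - t) * l j) ≤ 1 :=
      prod_le_one (fun j _ => add_nonneg (mul_nonneg ht0 (hu0 j)) (mul_nonneg ht' (hl0 j))) fun j _ => hle1 j
    rw [hn, pow_zero]; exact hP1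
  set J : Finset (Fin n) := univ.erase k with hJ
  have hJne : J.Nonempty := by
    have h2 : 1 < (univ : Finset (Fin n)).card := by rw [card_univ, Fintype.card_fin]; omega
    obtain ⟨j, hj, hjk⟩ := exists_mem_ne h2 k
    exact ⟨j, mem_erase.2 ⟨hjk, hj⟩⟩
  have hJcard : J.card = n - 1 := by rw [hJ, card_erase_of_mem (mem_univ k), card_univ, Fintype.card_fin]
  have hmerge := aligned_merge_prod_le ht0 ht1 hav0 hgv0 J hJne u l (fun j _ => hu0 j) (fun j _ => hl0 j)
    (fun j hj => halj j (mem_erase.1 hj).1)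
  rw [hJcard] at hmerge
  set PU : ℝ := ∏ j ∈ J, u j with hPU
  set PL : ℝ := ∏ j ∈ J, l j with hPL
  have hPU0 : 0 ≤ PU := prod_nonneg fun j _ => hu0 j
  have hPL0 : 0 ≤ PL := prod_nonneg fun j _ => hl0 j
  have hn12 : n - 1 = (n - 2) + 1 := by omega
  have hapow : 0 < av ^ (n - 2) := pow_pos hav0 _
  have hgpow : 0 < gv ^ (n - 2) := pow_pos hgv0 _
  -- the three coefficient bounds, in un-normalised form
  have hT : PU * u k ≤ av ^ (n - 2) * av := by
    have e1 : ∏ j, u j = u k * PU := by rw [hPU, hJ, mul_prod_erase univ u (mem_univ k)]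
    have e2 : av ^ (n - 1) = av ^ (n - 2) * av := by rw [hn12, pow_succ]
    rw [e1, e2] at hBu; linarith [hBu, mul_comm (u k) PU]
  have hC : PL * l k ≤ gv ^ (n - 2) * gv := by
    have e1 : ∏ j, l j = l k * PL := by rw [hPL, hJ, mul_prod_erase univ l (mem_univ k)]
    have e2 : gv ^ (n - 1) = gv ^ (n - 2) * gv := by rw [hn12, pow_succ]
    rw [e1, e2] at hBl; linarith [hBl, mul_comm (l k) PL]
  have hXk : PU * l k * gv ^ (n - 2) + PL * u k * av ^ (n - 2) ≤ (av + gv) * av ^ (n - 2) * gv ^ (n - 2) := by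
    have key := hX n e g f h y x k hn2 he hg hf hh hh1 leg lef lgh lfh ly hy1 lx hx1 Be Bg Bf Bh Br0 Br1 Bc0 Bc1 BA By Bx hxl
    have e1 : ∏ j ∈ univ.erase k, (τ + (1 - τ) * (s + (1 - s) * x j)) = PU := by rw [hPU, hJ]
    have e2 : ∏ j ∈ univ.erase k, (τ * (σ + (1 - σ) * y j) +
        (1 - τ) * ((1 - σ) * ((1 - s) * e j + s * g j) + σ * ((1 - s) * f j + s * h j))) = PL := by rw [hPL, hJ]
    rw [e1, e2] at key
    have e3 : τ * (σ + (1 - σ) * y k) + (1 - τ) * ((1 - σ) * ((1 - s) * e k + s * g k) + σ * ((1 - s) * f k + s * h k)) = l k := by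
      simp only [hl]
    have e4 : τ + (1 - τ) * (s + (1 - s) * x k) = u k := by simp only [hu]
    rw [e3, e4, ← hb, ← hβ, ← hc, ← hgv, ← hav] at key
    exact key
  -- the two-body bound
  have two : (t * u k + (1 - t) * l k) * (t * (PU / av ^ (n - 2)) + (1 - t) * (PL / gv ^ (n - 2))) ≤ t * av + (1 - t) * gv := by
    have hT' : PU / av ^ (n - 2) * u k ≤ av := by
      rw [div_mul_eq_mul_div, div_le_iff₀ hapow]; linarith [hT]
    have hC' : PL / gv ^ (n - 2) * l k ≤ gv := by
      rw [div_mul_eq_mul_div, div_le_iff₀ hgpow]; linarith [hC]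
    have hX' : PU / av ^ (n - 2) * l k + PL / gv ^ (n - 2) * u k ≤ av + gv := by
      have e1 : PU / av ^ (n - 2) * l k + PL / gv ^ (n - 2) * u k =
          (PU * l k * gv ^ (n - 2) + PL * u k * av ^ (n - 2)) / (av ^ (n - 2) * gv ^ (n - 2)) := by
        field_simp
      rw [e1, div_le_iff₀ (mul_pos hapow hgpow)]
      have e2 : (av + gv) * (av ^ (n - 2) * gv ^ (n - 2)) = (av + gv) * av ^ (n - 2) * gv ^ (n - 2) := by ring
      rw [e2]; exact hXk
    have k1 := mul_le_mul_of_nonneg_left hT' (mul_nonneg ht0 ht0)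
    have k2 := mul_le_mul_of_nonneg_left hC' (mul_nonneg ht' ht')
    have k3 := mul_le_mul_of_nonneg_left hX' (mul_nonneg ht0 ht')
    have e1 : (t * u k + (1 - t) * l k) * (t * (PU / av ^ (n - 2)) + (1 - t) * (PL / gv ^ (n - 2))) =
        t * t * (PU / av ^ (n - 2) * u k) + (1 - t) * (1 - t) * (PL / gv ^ (n - 2) * l k) +
        t * (1 - t) * (PU / av ^ (n - 2) * l k + PL / gv ^ (n - 2) * u k) := by ring
    have e2 : t * av + (1 - t) * gv = t * t * av + (1 - t) * (1 - t) * gv + t * (1 - t) * (av + gv) := by ring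
    rw [e1, e2]; linarith
  -- assemble
  have hfk0 : 0 ≤ t * u k + (1 - t) * l k := add_nonneg (mul_nonneg ht0 (hu0 k)) (mul_nonneg ht' (hl0 k))
  have hF0 : 0 ≤ t * av + (1 - t) * gv := add_nonneg (mul_nonneg ht0 hav0.le) (mul_nonneg ht' hgv0.le)
  rw [← mul_prod_erase univ (fun j => t * u j + (1 - t) * l j) (mem_univ k)]
  calc (t * u k + (1 - t) * l k) * ∏ j ∈ univ.erase k, (t * u j + (1 - t) * l j)
      ≤ (t * u k + (1 - t) * l k) * ((t * av + (1 - t) * gv) ^ (n - 1 - 1) *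
          (t * (PU / av ^ (n - 1 - 1)) + (1 - t) * (PL / gv ^ (n - 1 - 1)))) := mul_le_mul_of_nonneg_left hmerge hfk0
    _ = (t * av + (1 - t) * gv) ^ (n - 2) *
          ((t * u k + (1 - t) * l k) * (t * (PU / av ^ (n - 2)) + (1 - t) * (PL / gv ^ (n - 2)))) := by
        rw [show n - 1 - 1 = n - 2 by omega]; ring
    _ ≤ (t * av + (1 - t) * gv) ^ (n - 2) * (t * av + (1 - t) * gv) := mul_le_mul_of_nonneg_left two (pow_nonneg hF0 _)
    _ = (t * av + (1 - t) * gv) ^ (n - 1) := by rw [hn12, pow_succ]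

end LeafLeafZ

end SafeCalc

end Summit.CriticalPhenomena.PercolationContinuityZ3.Theorems.SunflowerPartition
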